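import Literature.MathematicalPhysics.QuantumFieldTheory.Balaban1983to89.B9Ineq344DualComparisonTorus

/-!
# `Balaban1983to89.B9Ineq344CutoffDatumTorus` — [B9] (3.44)–(3.45) AT U = 1 ON THE TORUS: THE CUT-OFF HALF OF THE COMMUTATOR
# DATUM OF THE DUAL COMPARISON (`B9Ineq344DualComparisonTorus.CommDatum`) REALISED BY THE BLOCK-SCALE PRODUCT CUT-OFFS —
# the far cut-off `χ_{s′}`, the near cut-off `1 − (1 − χ_s)(1 − χ_{s′})`, their first ∕ second differences, plateaux and supports
# in block terms, the block neighbourhoods `𝒩_r(s′)` that carry the commutator, and the (2.61)-count of `𝒩_r(s′)`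

T. Bałaban, *Propagators for lattice gauge theories in a background field*, Commun. Math. Phys. **99** (1985) 389–434
[`Balaban1985BackgroundPropagators`, "B9"]; [4] = T. Bałaban, *Propagators and renormalization transformations for lattice
gauge theories. II*, Commun. Math. Phys. **96** (1984) 223–250 [`Balaban1984PropagatorsII`]; [B5] = T. Bałaban, *Propagators and
renormalization transformations for lattice gauge theories. I*, Commun. Math. Phys. **95** (1984) 17–40 [`Balaban1984PropagatorsI`].

statement-level skeleton of published theorems with citation tags; proofs where landed; nothing here is a claim about the
Yang–Mills mass gap

THE PRINTED LOCI (verbatim).  [B9] (3.44)–(3.45) p. 398 (*"x ∈ Δ(y), supp λ ⊂ Δ̃(y′)"*); [B5] (1.118) p. 36 (the partition functions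
`h`, *"h(t) = 1 for t ∈ [−½, ½]"*), (1.121) p. 37 (`Δh A = hΔ_aA − K(h)A`: the commutator is carried by the differences of `h`), (1.128)
p. 38 (the bound of `hK(h)`); [4] (2.46) p. 231 (the block distance `d`), Lemma 2.1 (2.61) p. 234 (the row sums `Σ_{y′}e^{−δ₀d(y,y′)}`).

THE POINT.  This seat's FILE 16 (`B9Ineq344DualComparisonTorus`) reduced (3.44)∕(3.45) for the multilevel `G′ = gmlT` to local
second-order data of a comparison operator, relative to a COMMUTATOR DATUM `CommDatum D a 𝒩 χ A^c V^c K₁ K₂ κ_c κ` whose cut-off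
half (`χ ∈ [0,1]`, `|∂χ| ≤ K₁`, `|∂∂χ| ≤ K₂`, the `1`-neighbourhood of `supp χ` in the blocks of `𝒩`) and whose plateau ∕ stencil
hypotheses (`χ ≡ 1` on the `∂_ν`-stencil of `supp λ`, `χ(x) = χ(x+e_μ) = c`) were left abstract.  THIS FILE realises that half
with dag-n06-h g3's block-scale cut-off `cutoffT` (FILE 12):

* §1 cut-off calculus on the torus: `cutoffT_second_le` (the pure second difference `|2χ_y − χ_y(·+e_μ) − χ_y(·−e_μ)| ≤ 2∕(L^j)²`, per
  direction), the NEAR cut-off `nearCut D s s′ := 1 − (1 − χ_s)(1 − χ_{s′})` with `nearCut_nonneg ∕ le_one ∕ lipschitz ∕ second`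
  (`K₁ = 2∕L^{j} + 2∕L^{j′}`, `K₂ = 2∕L^{2j} + 2∕L^{2j′} + 2(2∕L^j)(4∕L^{j′})`), `nearCut_eq_one_of` (plateau where either factor is `1`),
  `nearCut_ne_zero` (support inside the union of the two supports);
* §2 block geometry of translates: `torusSupNorm_tshift_unit_le` (`|σ_v y − y|_T ≤ 1` for `|v|_∞ ≤ 1`), ★ `distT_blkOf_tshift_le`
  (`d_T(y(σ_v y), y(y)) ≤ 2(d+1)`), the neighbourhoods `nbhdT D s′ r` and ★ `mem_nbhdT_of_cutoffT_tshift_ne_zero` (a site a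
  `χ_{s′}`-translate of which is non-zero lies in `𝒩_{c₀+2(d+1)}(s′)`, `c₀ = (d+1)(4L+1)`), `mem_nbhdT_of_nearCut_tshift_ne_zero`;
* §3 the plateau ∕ stencil facts: `cutoffT_plateau_supp` (`λ ⊂ B(s′)` ⇒ `χ_{s′} ≡ 1` on the `∂_ν`-stencil of `supp λ`), `nearCut_plateau_supp`,
  `cutoffT_far_stencil` (far case: `d_T(s,s′) > c₀ + 2(d+1)` ⇒ `χ_{s′}(x) = χ_{s′}(x+e_μ) = 0` for `x ∈ B(s)`), `nearCut_near_stencil`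
  (`x ∈ B(s)` ⇒ `nearCut(x) = nearCut(x+e_μ) = 1`);
* §4 the (2.61)-COUNT: `card_nbhdT_le` (`#𝒩_r(s′) ≤ c·e^{¼δr}` from `Ineq261With c (geomT D) δ ¼`) and ★ `sum_nbhdT_weight_le` (the row-sum
  shape of FILE 16's conclusion: `Σ_{t∈𝒩_r(s′)} e^{−½δ₀d_T(s,t)} ≤ #𝒩_r(s′)·e^{½δ₀r}·e^{−½δ₀d_T(s,s′)}`).

HONEST SCOPE.  Torus geometry ∕ cut-off bookkeeping only (the `χ`-half of the datum and the counting); the comparison-operator half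
(`A^c, G^c, V^c` and their local (1.110)₃∕(1.112)∕(1.113) data) remains displayed, as in FILE 16.  Nothing of [B9]∕[4]∕[B5] is asserted;
count-neutral; N06 NOT discharged; one finite lattice programme — nothing continuum, nothing about the mass gap.  Cell `pub-ymgap`
(HUMAN RULING D-0062), Track A node N06 [B9], N06-ASSIGNMENT v1 row 11 (bundle F3), seat `pub-ymgap-dag-n06-h` (g4), 2026-08-27.
-/

noncomputable section

namespace Literature.MathematicalPhysics.QuantumFieldTheory.Balaban1983to89.B9Ineq344CutoffDatumTorus

open Finset Matrix
open B4Reflection242 (boxDom)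
open B4TorusKernel.MultiPeriod (torusSupNorm circAbs circAbs_le_abs circAbs_nonneg torusSupNorm_translate translate)
open B6MultiLevelBoxOperator (N0 bigSide)
open B6MultiLevelTorusOperator
open B6Geom246MultiLevelBox (bset blkOf)
open B6Geom246MultiLevelTorus (bondT connectedT geomT)
open B6Lemma21Repaired (Ineq261With)
open B9Ineq346SecondOrderTorusCutoff (cutoffT side ctr cut1 prof tentSum cutoffT_nonneg cutoffT_le_one cutoffT_tshift cutoffT_lipschitz
  cutoffT_plateau_shifts distT_le_of_cutoffT_ne_zero distT_blkOf_le_of_torusSupNorm lev_ge_of_torusSupNorm_le one_le_side six_side_le_N0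
  tentSum_ge tentSum_pos cut1_nonneg cut1_le_one abs_cut1_second_le)

variable {d : ℕ}

/-! ## §1 Cut-off calculus: the pure second difference of `χ_y`; the near cut-off -/

section Calculus

variable {ℓ Mh k R : ℕ} {P : Fin (d + 1) → ℕ} (D : TDomains d ℓ Mh k P R) (y : ↥(bset D.toDomains))

/-- a product over the coordinates with one factor changed. [folklore] -/
private theorem prod_update_sub' (f : Fin (d + 1) → ℝ) (μ : Fin (d + 1)) (a : ℝ) :
    (∏ ν, Function.update f μ a ν) - ∏ ν, f ν = (a - f μ) * ∏ ν ∈ Finset.univ.erase μ, f ν := by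
  rw [← Finset.mul_prod_erase Finset.univ (Function.update f μ a) (Finset.mem_univ μ),
    ← Finset.mul_prod_erase Finset.univ f (Finset.mem_univ μ), Function.update_self, sub_mul]
  congr 2
  exact Finset.prod_congr rfl fun ν hν => by rw [Function.update_of_ne (Finset.ne_of_mem_erase hν)]

/-- the translate by `ε·e_μ` changes only the `μ`-th factor of the product cut-off. [cite: Balaban1983RegularityDecay, p.572, dictionary] -/
private theorem cutoffT_tshift_unit' (μ : Fin (d + 1)) (ε : ℤ) (x : ↥(boxDom (N0 ℓ Mh k P))) :
    cutoffT D y (tshift (N0 ℓ Mh k P) (ε • unitVec μ) x)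
      = ∏ ν, Function.update (fun ν => cut1 (side D y) (N0 ℓ Mh k P ν) (ctr D y ν) (x.1 ν)) μ
          (cut1 (side D y) (N0 ℓ Mh k P μ) (ctr D y μ) (x.1 μ + ε)) ν := by
  rw [cutoffT_tshift]
  refine Finset.prod_congr rfl fun ν _ => ?_
  by_cases h : ν = μ
  · subst h; rw [Function.update_self]; simp [unitVec]
  · rw [Function.update_of_ne h]; simp [unitVec, h]

/-- ★ **THE PURE SECOND DIFFERENCE OF THE BLOCK CUT-OFF, PER DIRECTION**: `|2χ_y(x) − χ_y(x+e_μ) − χ_y(x−e_μ)| ≤ 2∕(L^j)²`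
(`M_h ≥ 3`, `P_μ ≥ 4`; the one-dimensional profile's second difference `≤ 1∕S_n ≤ 2∕(n(n+1))` times factors in `[0,1]`).
[cite: Balaban1984PropagatorsI, (1.118) p.36, (1.128) p.38 (bounds of the differences of h), dictionary] -/
theorem cutoffT_second_le (hℓ : 1 ≤ ℓ) (hMh : 3 ≤ Mh) (hP4 : ∀ μ, 4 ≤ P μ) (μ : Fin (d + 1)) (x : ↥(boxDom (N0 ℓ Mh k P))) :
    |2 * cutoffT D y x - cutoffT D y (tshift (N0 ℓ Mh k P) (unitVec μ) x) - cutoffT D y (tshift (N0 ℓ Mh k P) (-unitVec μ) x)|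
      ≤ 2 / ((side D y : ℝ) ^ 2) := by
  have hn := one_le_side D y
  have hMh1 : 1 ≤ Mh := le_trans (by norm_num) hMh
  have hP : ∀ μ, 1 ≤ P μ := fun μ => le_trans (by norm_num) (hP4 μ)
  have hSpos : (0 : ℝ) < tentSum (side D y) := by exact_mod_cast tentSum_pos hn
  have h1 := cutoffT_tshift_unit' D y μ 1 x
  have h2 := cutoffT_tshift_unit' D y μ (-1) x
  rw [one_smul] at h1
  rw [neg_one_smul] at h2
  set f : Fin (d + 1) → ℝ := fun ν => cut1 (side D y) (N0 ℓ Mh k P ν) (ctr D y ν) (x.1 ν) with hf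
  have e0 : cutoffT D y x = ∏ ν, f ν := rfl
  have e : 2 * cutoffT D y x - cutoffT D y (tshift (N0 ℓ Mh k P) (unitVec μ) x)
      - cutoffT D y (tshift (N0 ℓ Mh k P) (-unitVec μ) x)
      = -((cut1 (side D y) (N0 ℓ Mh k P μ) (ctr D y μ) (x.1 μ + 1) - 2 * f μ
          + cut1 (side D y) (N0 ℓ Mh k P μ) (ctr D y μ) (x.1 μ + -1)) * ∏ ν ∈ Finset.univ.erase μ, f ν) := by
    have d1 := prod_update_sub' f μ (cut1 (side D y) (N0 ℓ Mh k P μ) (ctr D y μ) (x.1 μ + 1))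
    have d2 := prod_update_sub' f μ (cut1 (side D y) (N0 ℓ Mh k P μ) (ctr D y μ) (x.1 μ + -1))
    rw [h1, h2, e0]
    linear_combination (-1 : ℝ) * d1 - d2
  rw [e, abs_neg, abs_mul]
  have hprod : |∏ ν ∈ Finset.univ.erase μ, f ν| ≤ 1 := by
    rw [abs_of_nonneg (Finset.prod_nonneg fun ν _ => cut1_nonneg _ hn _)]
    exact Finset.prod_le_one (fun ν _ => cut1_nonneg _ hn _) fun ν _ => cut1_le_one _ _
  have hsec := abs_cut1_second_le (N := N0 ℓ Mh k P μ) (ctr D y μ) hn (one_le_N0 (ℓ := ℓ) (k := k) hMh1 hP μ)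
    (six_side_le_N0 D y hℓ hMh hP4 μ) (x.1 μ)
  rw [show x.1 μ + -1 = x.1 μ - 1 by ring]
  have hS := tentSum_ge (side D y)
  have hS' : ((side D y : ℕ) : ℝ) * ((side D y : ℝ) + 1) ≤ 2 * tentSum (side D y) := by exact_mod_cast hS
  have hn' : (1 : ℝ) ≤ side D y := by exact_mod_cast hn
  calc _ ≤ 1 / (tentSum (side D y) : ℝ) * 1 := mul_le_mul hsec hprod (abs_nonneg _) (by positivity)
    _ = 1 / (tentSum (side D y) : ℝ) := mul_one _
    _ ≤ 2 / ((side D y : ℝ) ^ 2) := by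
        rw [div_le_div_iff₀ hSpos (by positivity)]
        nlinarith

variable (s s' : ↥(bset D.toDomains))

/-- **THE NEAR CUT-OFF** of the pair `(s, s′)`: `1 − (1 − χ_s)(1 − χ_{s′})` — equal to `1` wherever `χ_s = 1` or `χ_{s′} = 1`, supported in
`supp χ_s ∪ supp χ_{s′}`. [cite: Balaban1984PropagatorsI, (1.118) p.36 (partition functions), dictionary] -/
def nearCut (x : ↥(boxDom (N0 ℓ Mh k P))) : ℝ := 1 - (1 - cutoffT D s x) * (1 - cutoffT D s' x)

/-- `0 ≤ nearCut`. [cite: Balaban1984PropagatorsI, (1.118) p.36, dictionary] -/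
theorem nearCut_nonneg (x : ↥(boxDom (N0 ℓ Mh k P))) : 0 ≤ nearCut D s s' x := by
  unfold nearCut
  have h1 := cutoffT_nonneg D s x; have h2 := cutoffT_le_one D s x
  have h3 := cutoffT_nonneg D s' x; have h4 := cutoffT_le_one D s' x
  nlinarith [mul_le_mul (sub_le_self 1 h1) (sub_le_self 1 h3) (by linarith) (by linarith)]

/-- `nearCut ≤ 1`. [cite: Balaban1984PropagatorsI, (1.118) p.36, dictionary] -/
theorem nearCut_le_one (x : ↥(boxDom (N0 ℓ Mh k P))) : nearCut D s s' x ≤ 1 := by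
  unfold nearCut
  have h2 := cutoffT_le_one D s x; have h4 := cutoffT_le_one D s' x
  nlinarith [mul_nonneg (sub_nonneg.2 h2) (sub_nonneg.2 h4)]

/-- `nearCut = 1` wherever one of the two block cut-offs is `1`. [cite: Balaban1984PropagatorsI, (1.118) p.36, dictionary] -/
theorem nearCut_eq_one_of {x : ↥(boxDom (N0 ℓ Mh k P))} (h : cutoffT D s x = 1 ∨ cutoffT D s' x = 1) : nearCut D s s' x = 1 := by
  unfold nearCut
  rcases h with h | h <;> rw [h] <;> ring

/-- `nearCut ≠ 0` forces one of the two block cut-offs to be non-zero. [cite: Balaban1984PropagatorsI, (1.118) p.36, dictionary] -/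
theorem nearCut_ne_zero {x : ↥(boxDom (N0 ℓ Mh k P))} (h : nearCut D s s' x ≠ 0) : cutoffT D s x ≠ 0 ∨ cutoffT D s' x ≠ 0 := by
  by_contra hc
  push Not at hc
  apply h
  unfold nearCut
  rw [hc.1, hc.2]; ring

/-- the first difference of the near cut-off: `|Δω| ≤ |Δχ_s| + |Δχ_{s′}|` (the factors `1 − χ` lie in `[0,1]`).
[cite: Balaban1984PropagatorsI, (1.128) p.38 (bounds of the differences of h), dictionary] -/
theorem nearCut_sub_le (x x' : ↥(boxDom (N0 ℓ Mh k P))) :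
    |nearCut D s s' x' - nearCut D s s' x| ≤ |cutoffT D s x' - cutoffT D s x| + |cutoffT D s' x' - cutoffT D s' x| := by
  unfold nearCut
  set u := 1 - cutoffT D s x with hu
  set u' := 1 - cutoffT D s x' with hu'
  set v := 1 - cutoffT D s' x with hv
  set v' := 1 - cutoffT D s' x' with hv'
  have hv'0 : 0 ≤ v' := by rw [hv']; linarith [cutoffT_le_one D s' x']
  have hv'1 : v' ≤ 1 := by rw [hv']; linarith [cutoffT_nonneg D s' x']
  have hu0 : 0 ≤ u := by rw [hu]; linarith [cutoffT_le_one D s x]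
  have hu1 : u ≤ 1 := by rw [hu]; linarith [cutoffT_nonneg D s x]
  have e : 1 - u' * v' - (1 - u * v) = -((u' - u) * v' + u * (v' - v)) := by ring
  rw [e, abs_neg]
  calc |(u' - u) * v' + u * (v' - v)| ≤ |(u' - u) * v'| + |u * (v' - v)| := abs_add_le _ _
    _ = |u' - u| * |v'| + |u| * |v' - v| := by rw [abs_mul, abs_mul]
    _ ≤ |u' - u| * 1 + 1 * |v' - v| := by
        refine add_le_add (mul_le_mul_of_nonneg_left ?_ (abs_nonneg _)) (mul_le_mul_of_nonneg_right ?_ (abs_nonneg _))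
        · rw [abs_of_nonneg hv'0]; exact hv'1
        · rw [abs_of_nonneg hu0]; exact hu1
    _ = |cutoffT D s x' - cutoffT D s x| + |cutoffT D s' x' - cutoffT D s' x| := by
        rw [mul_one, one_mul, hu, hu', hv, hv']
        congr 1 <;> rw [← abs_neg] <;> congr 1 <;> ring

/-- **THE LIPSCHITZ BOUND OF THE NEAR CUT-OFF**: `|ω(x+e_μ) − ω(x)| ≤ 2∕L^{j(s)} + 2∕L^{j(s′)}`.
[cite: Balaban1984PropagatorsI, (1.128) p.38, dictionary] -/
theorem nearCut_lipschitz (hMh : 1 ≤ Mh) (hP : ∀ μ, 1 ≤ P μ) (μ : Fin (d + 1)) (x : ↥(boxDom (N0 ℓ Mh k P))) :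
    |nearCut D s s' (tshift (N0 ℓ Mh k P) (unitVec μ) x) - nearCut D s s' x| ≤ 2 / (side D s : ℝ) + 2 / (side D s' : ℝ) :=
  (nearCut_sub_le D s s' x _).trans (add_le_add (cutoffT_lipschitz D s hMh hP μ x) (cutoffT_lipschitz D s' hMh hP μ x))

/-- **THE SECOND DIFFERENCE OF THE NEAR CUT-OFF, PER DIRECTION**:
`|2ω(x) − ω(x+e_μ) − ω(x−e_μ)| ≤ 2∕L^{2j(s)} + 2∕L^{2j(s′)} + 2·(2∕L^{j(s)})·(2∕L^{j(s′)})`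
(`Δ²(uv) = (Δ²u)v⁻ + (Δ⁺u)(v⁺ − v⁻) + u(Δ²v)`). [cite: Balaban1984PropagatorsI, (1.128) p.38, dictionary] -/
theorem nearCut_second_le (hℓ : 1 ≤ ℓ) (hMh : 3 ≤ Mh) (hP4 : ∀ μ, 4 ≤ P μ) (μ : Fin (d + 1)) (x : ↥(boxDom (N0 ℓ Mh k P))) :
    |2 * nearCut D s s' x - nearCut D s s' (tshift (N0 ℓ Mh k P) (unitVec μ) x) - nearCut D s s' (tshift (N0 ℓ Mh k P) (-unitVec μ) x)|
      ≤ 2 / ((side D s : ℝ) ^ 2) + 2 / ((side D s' : ℝ) ^ 2) + 2 * (2 / (side D s : ℝ)) * (2 / (side D s' : ℝ)) := by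
  have hMh1 : 1 ≤ Mh := le_trans (by norm_num) hMh
  have hP : ∀ μ, 1 ≤ P μ := fun μ => le_trans (by norm_num) (hP4 μ)
  unfold nearCut
  set xp := tshift (N0 ℓ Mh k P) (unitVec μ) x with hxp
  set xm := tshift (N0 ℓ Mh k P) (-unitVec μ) x with hxm
  set u := 1 - cutoffT D s x with hu
  set up := 1 - cutoffT D s xp with hup
  set um := 1 - cutoffT D s xm with hum
  set v := 1 - cutoffT D s' x with hv
  set vp := 1 - cutoffT D s' xp with hvp
  set vm := 1 - cutoffT D s' xm with hvm
  have hu0 : 0 ≤ u := by rw [hu]; linarith [cutoffT_le_one D s x]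
  have hu1 : u ≤ 1 := by rw [hu]; linarith [cutoffT_nonneg D s x]
  have hvm0 : 0 ≤ vm := by rw [hvm]; linarith [cutoffT_le_one D s' xm]
  have hvm1 : vm ≤ 1 := by rw [hvm]; linarith [cutoffT_nonneg D s' xm]
  -- the three differences of the factors
  have hU2 : |2 * u - up - um| ≤ 2 / ((side D s : ℝ) ^ 2) := by
    have h := cutoffT_second_le D s hℓ hMh hP4 μ x
    rw [hu, hup, hum, ← abs_neg]
    refine le_trans (le_of_eq ?_) h
    congr 1; ring
  have hV2 : |2 * v - vp - vm| ≤ 2 / ((side D s' : ℝ) ^ 2) := by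
    have h := cutoffT_second_le D s' hℓ hMh hP4 μ x
    rw [hv, hvp, hvm, ← abs_neg]
    refine le_trans (le_of_eq ?_) h
    congr 1; ring
  have hU1 : |up - u| ≤ 2 / (side D s : ℝ) := by
    have h := cutoffT_lipschitz D s hMh1 hP μ x
    rw [hu, hup, ← abs_neg]
    refine le_trans (le_of_eq ?_) h
    congr 1; ring
  have hV1 : |vp - vm| ≤ 2 * (2 / (side D s' : ℝ)) := by
    have h1 := cutoffT_lipschitz D s' hMh1 hP μ x
    have h2 := cutoffT_lipschitz D s' hMh1 hP μ xm
    have hxmp : tshift (N0 ℓ Mh k P) (unitVec μ) xm = x := by rw [hxm, tshift_tshift, neg_add_cancel, tshift_zero]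
    rw [hxmp] at h2
    have e : vp - vm = -(cutoffT D s' xp - cutoffT D s' x) - (cutoffT D s' x - cutoffT D s' xm) := by rw [hvp, hvm]; ring
    rw [e]
    calc _ ≤ |-(cutoffT D s' xp - cutoffT D s' x)| + |cutoffT D s' x - cutoffT D s' xm| := abs_sub _ _
      _ ≤ 2 / (side D s' : ℝ) + 2 / (side D s' : ℝ) := by rw [abs_neg]; exact add_le_add h1 h2
      _ = 2 * (2 / (side D s' : ℝ)) := by ring
  -- `2ω − ω⁺ − ω⁻ = u⁺v⁺ − 2uv + u⁻v⁻ = (u⁺ − 2u + u⁻)v⁻ + (u⁺ − u)(v⁺ − v⁻) + u(v⁺ − 2v + v⁻)`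
  have e : 2 * (1 - u * v) - (1 - up * vp) - (1 - um * vm)
      = -((2 * u - up - um) * vm) + (up - u) * (vp - vm) - u * (2 * v - vp - vm) := by ring
  rw [e]
  calc |-((2 * u - up - um) * vm) + (up - u) * (vp - vm) - u * (2 * v - vp - vm)|
      ≤ |-((2 * u - up - um) * vm) + (up - u) * (vp - vm)| + |u * (2 * v - vp - vm)| := abs_sub _ _
    _ ≤ |-((2 * u - up - um) * vm)| + |(up - u) * (vp - vm)| + |u * (2 * v - vp - vm)| := by
        linarith [abs_add_le (-((2 * u - up - um) * vm)) ((up - u) * (vp - vm))]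
    _ = |2 * u - up - um| * |vm| + |up - u| * |vp - vm| + |u| * |2 * v - vp - vm| := by
        rw [abs_neg, abs_mul, abs_mul, abs_mul]
    _ ≤ 2 / ((side D s : ℝ) ^ 2) * 1 + 2 / (side D s : ℝ) * (2 * (2 / (side D s' : ℝ))) + 1 * (2 / ((side D s' : ℝ) ^ 2)) := by
        refine add_le_add (add_le_add ?_ ?_) ?_
        · exact mul_le_mul hU2 (by rw [abs_of_nonneg hvm0]; exact hvm1) (abs_nonneg _) (by positivity)
        · exact mul_le_mul hU1 hV1 (abs_nonneg _) (by positivity)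
        · exact mul_le_mul (by rw [abs_of_nonneg hu0]; exact hu1) hV2 (abs_nonneg _) zero_le_one
    _ = _ := by ring

end Calculus

/-! ## §2 Block geometry of unit translates; the neighbourhoods `𝒩_r(s′)` carrying the commutator -/

section Geometry

variable {ℓ Mh k R : ℕ} {P : Fin (d + 1) → ℕ} (D : TDomains d ℓ Mh k P R)

omit D in
/-- a translate by a vector of sup-length `≤ 1` is at torus distance `≤ 1`. [cite: Balaban1983RegularityDecay, p.572 («periodic conditions»), dictionary] -/
theorem torusSupNorm_tshift_unit_le {N : Fin (d + 1) → ℕ} (hN : ∀ i, 1 ≤ N i) (v : Fin (d + 1) → ℤ) (hv : ∀ μ, |v μ| ≤ 1)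
    (y : ↥(boxDom N)) : torusSupNorm N ((tshift N v y).1 - y.1) ≤ 1 := by
  obtain ⟨m, hm⟩ := tshift_val_eq_translate N v y
  have e : (tshift N v y).1 - y.1 = translate N v m := by
    rw [hm]; funext i
    rw [Pi.sub_apply, B4TorusKernel.MultiPeriod.translate_apply, B4TorusKernel.MultiPeriod.translate_apply, Pi.add_apply]
    ring
  rw [e, torusSupNorm_translate]
  unfold torusSupNorm
  refine Finset.sup'_le _ _ fun i _ => ?_
  have h1 : ((circAbs (N i) (v i) : ℤ) : ℝ) ≤ ((|v i| : ℤ) : ℝ) := by exact_mod_cast circAbs_le_abs (hN i) (v i)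
  have h2 : ((|v i| : ℤ) : ℝ) ≤ 1 := by exact_mod_cast hv i
  exact h1.trans h2

/-- ★ **NEIGHBOURING SITES LIE IN `d`-CLOSE BLOCKS**: for `|v|_∞ ≤ 1`, `d_T(y(σ_v y), y(y)) ≤ 2(d+1)` (`M_h ≥ 3`, `R ≥ 2L`, `P_μ ≥ 4`) —
g3's `distT_blkOf_le_of_torusSupNorm` at radius `1` with the level window of `lev_ge_of_torusSupNorm_le`.
[cite: Balaban1984PropagatorsII, (2.46) p.231, (2.2) p.224, dictionary] -/
theorem distT_blkOf_tshift_le (hMh : 3 ≤ Mh) (hR : 2 * (ℓ + 1) ≤ R) (hP4 : ∀ μ, 4 ≤ P μ) (v : Fin (d + 1) → ℤ)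
    (hv : ∀ μ, |v μ| ≤ 1) (y : ↥(boxDom (N0 ℓ Mh k P))) :
    (bondT D).dist (blkOf D.toDomains (tshift (N0 ℓ Mh k P) v y)) (blkOf D.toDomains y) ≤ 2 * (d + 1) := by
  have hMh1 : 1 ≤ Mh := le_trans (by norm_num) hMh
  have hP : ∀ μ, 1 ≤ P μ := fun μ => le_trans (by norm_num) (hP4 μ)
  have hN1 := one_le_N0 (ℓ := ℓ) (k := k) hMh1 hP
  have hsup : torusSupNorm (N0 ℓ Mh k P) ((tshift (N0 ℓ Mh k P) v y).1 - y.1) ≤ ((1 : ℕ) : ℝ) := by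
    exact_mod_cast torusSupNorm_tshift_unit_le hN1 v hv y
  have hb : 1 ≤ bigSide ℓ Mh k := B6MultiLevelBoxOperator.one_le_bigSide hMh1 k
  -- every site within torus distance `1` of `y` has level `≥ lev y − 1` (`R·bigSide ≥ 1`)
  have hlev : ∀ w : ↥(boxDom (N0 ℓ Mh k P)), torusSupNorm (N0 ℓ Mh k P) (w.1 - y.1) ≤ ((1 : ℕ) : ℝ) →
      D.lev y.1 - 1 ≤ D.lev w.1 := by
    intro w hw
    refine lev_ge_of_torusSupNorm_le D y w (ρ := ((1 : ℕ) : ℝ)) ?_ hw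
    have hb' : 1 ≤ bigSide ℓ Mh (D.lev y.1 - 1) := B6MultiLevelBoxOperator.one_le_bigSide (ℓ := ℓ) hMh1 (D.lev y.1 - 1)
    have h1 : 1 ≤ R * bigSide ℓ Mh (D.lev y.1 - 1) := Nat.one_le_iff_ne_zero.2 (Nat.mul_ne_zero (by omega) (by omega))
    exact_mod_cast h1
  have h := distT_blkOf_le_of_torusSupNorm D hMh1 hP hP4 (i := D.lev y.1 - 1) (ρ := 1) hb (tshift (N0 ℓ Mh k P) v y) y hsup hlev
  have hfin : (((bondT D).dist (blkOf D.toDomains (tshift (N0 ℓ Mh k P) v y)) (blkOf D.toDomains y) : ℕ) : ℝ) ≤ 2 * ((d : ℝ) + 1) := by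
    refine h.trans ?_
    have hq : ((1 : ℕ) : ℝ) / ((((ℓ + 1) ^ (D.lev y.1 - 1) : ℕ) : ℝ)) ≤ 1 := by
      rw [div_le_one (by positivity)]
      exact_mod_cast Nat.one_le_pow _ _ (by omega)
    nlinarith [hq, (by positivity : (0 : ℝ) ≤ (d : ℝ) + 1)]
  exact_mod_cast hfin

/-- the blocks within `d`-distance `r` of `s′`. [cite: Balaban1984PropagatorsII, (2.46) p.231, dictionary] -/
def nbhdT (s' : ↥(bset D.toDomains)) (r : ℕ) : Finset ↥(bset D.toDomains) :=
  Finset.univ.filter (fun t => (bondT D).dist t s' ≤ r)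

/-- membership in `𝒩_r(s′)` unfolded. [cite: Balaban1984PropagatorsII, (2.46) p.231, dictionary] -/
theorem mem_nbhdT {s' t : ↥(bset D.toDomains)} {r : ℕ} : t ∈ nbhdT D s' r ↔ (bondT D).dist t s' ≤ r := by
  simp [nbhdT]

/-- `𝒩_r(s′) ⊆ 𝒩_{r′}(s′)` for `r ≤ r′`. [cite: Balaban1984PropagatorsII, (2.46) p.231, dictionary] -/
theorem nbhdT_mono (s' : ↥(bset D.toDomains)) {r r' : ℕ} (h : r ≤ r') : nbhdT D s' r ⊆ nbhdT D s' r' :=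
  fun _ ht => mem_nbhdT D |>.2 ((mem_nbhdT D |>.1 ht).trans h)

/-- the constant `c₀ = (d+1)(4L+1)` of the support of `χ_y` in block terms (g3's `distT_le_of_cutoffT_ne_zero`).
[cite: Balaban1985BackgroundPropagators, (3.46) p.398 («supp h ⊂ Δ̃(y)»), dictionary] -/
def c0 (d ℓ : ℕ) : ℕ := (d + 1) * (4 * (ℓ + 1) + 1)

/-- ★ a site one of whose unit translates carries `χ_{s′}` lies in a block of `𝒩_{c₀ + 2(d+1)}(s′)`.
[cite: Balaban1984PropagatorsI, (1.118) p.36 (supports of h and its differences); Balaban1984PropagatorsII, (2.46) p.231] -/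
theorem mem_nbhdT_of_cutoffT_tshift_ne_zero (hℓ : 1 ≤ ℓ) (hMh : 3 ≤ Mh) (hR : 2 * (ℓ + 1) ≤ R) (hP4 : ∀ μ, 4 ≤ P μ)
    (s' : ↥(bset D.toDomains)) (y : ↥(boxDom (N0 ℓ Mh k P))) (v : Fin (d + 1) → ℤ) (hv : ∀ μ, |v μ| ≤ 1)
    (hy : cutoffT D s' (tshift (N0 ℓ Mh k P) v y) ≠ 0) : blkOf D.toDomains y ∈ nbhdT D s' (c0 d ℓ + 2 * (d + 1)) := by
  have hMh1 : 1 ≤ Mh := le_trans (by norm_num) hMh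
  have hP : ∀ μ, 1 ≤ P μ := fun μ => le_trans (by norm_num) (hP4 μ)
  rw [mem_nbhdT]
  have h1 := distT_le_of_cutoffT_ne_zero D s' hℓ hMh hR hP4 hy
  have h2 := distT_blkOf_tshift_le D hMh hR hP4 v hv y
  have htri := (connectedT (D := D) hMh1 hP).dist_triangle (u := blkOf D.toDomains y)
    (v := blkOf D.toDomains (tshift (N0 ℓ Mh k P) v y)) (w := s')
  rw [SimpleGraph.dist_comm] at h2
  unfold c0
  omega

/-- a site one of whose unit translates carries the near cut-off lies in `𝒩(s)` or `𝒩(s′)`. [cite: Balaban1984PropagatorsI, (1.118) p.36; Balaban1984PropagatorsII, (2.46) p.231] -/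
theorem mem_nbhdT_of_nearCut_tshift_ne_zero (hℓ : 1 ≤ ℓ) (hMh : 3 ≤ Mh) (hR : 2 * (ℓ + 1) ≤ R) (hP4 : ∀ μ, 4 ≤ P μ)
    (s s' : ↥(bset D.toDomains)) (y : ↥(boxDom (N0 ℓ Mh k P))) (v : Fin (d + 1) → ℤ) (hv : ∀ μ, |v μ| ≤ 1)
    (hy : nearCut D s s' (tshift (N0 ℓ Mh k P) v y) ≠ 0) :
    blkOf D.toDomains y ∈ nbhdT D s (c0 d ℓ + 2 * (d + 1)) ∨ blkOf D.toDomains y ∈ nbhdT D s' (c0 d ℓ + 2 * (d + 1)) := by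
  rcases nearCut_ne_zero D s s' hy with h | h
  · exact Or.inl (mem_nbhdT_of_cutoffT_tshift_ne_zero D hℓ hMh hR hP4 s y v hv h)
  · exact Or.inr (mem_nbhdT_of_cutoffT_tshift_ne_zero D hℓ hMh hR hP4 s' y v hv h)

/-- … hence in `𝒩_{c₀ + 2(d+1) + d_T(s,s′)}(s′)` (triangle inequality). [cite: Balaban1984PropagatorsII, (2.46) p.231, dictionary] -/
theorem mem_nbhdT_of_nearCut_tshift_ne_zero' (hℓ : 1 ≤ ℓ) (hMh : 3 ≤ Mh) (hR : 2 * (ℓ + 1) ≤ R) (hP4 : ∀ μ, 4 ≤ P μ)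
    (s s' : ↥(bset D.toDomains)) (y : ↥(boxDom (N0 ℓ Mh k P))) (v : Fin (d + 1) → ℤ) (hv : ∀ μ, |v μ| ≤ 1)
    (hy : nearCut D s s' (tshift (N0 ℓ Mh k P) v y) ≠ 0) :
    blkOf D.toDomains y ∈ nbhdT D s' (c0 d ℓ + 2 * (d + 1) + (bondT D).dist s s') := by
  have hMh1 : 1 ≤ Mh := le_trans (by norm_num) hMh
  have hP : ∀ μ, 1 ≤ P μ := fun μ => le_trans (by norm_num) (hP4 μ)
  rw [mem_nbhdT]
  rcases mem_nbhdT_of_nearCut_tshift_ne_zero D hℓ hMh hR hP4 s s' y v hv hy with h | h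
  · rw [mem_nbhdT] at h
    have htri := (connectedT (D := D) hMh1 hP).dist_triangle (u := blkOf D.toDomains y) (v := s) (w := s')
    omega
  · rw [mem_nbhdT] at h
    omega

end Geometry

/-! ## §3 Plateau and stencil facts -/

section Stencil

variable {ℓ Mh k R : ℕ} {P : Fin (d + 1) → ℕ} (D : TDomains d ℓ Mh k P R) (s s' : ↥(bset D.toDomains))

/-- **`λ ⊂ B(s′)` ⇒ `χ_{s′} ≡ 1` ON THE `∂_ν`-STENCIL OF `supp λ`** (the plateau covers the block and its unit translates).
[cite: Balaban1985BackgroundPropagators, (3.44) p.398 («supp λ ⊂ Δ̃(y′)»), dictionary] -/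
theorem cutoffT_plateau_supp (hMh : 1 ≤ Mh) (hP : ∀ μ, 1 ≤ P μ) (ν : Fin (d + 1)) (lam : ↥(boxDom (N0 ℓ Mh k P)) → ℝ)
    (hlam : ∀ z, lam z ≠ 0 → blkOf D.toDomains z = s') :
    ∀ z, lam z ≠ 0 → cutoffT D s' z = 1 ∧ cutoffT D s' (tshift (N0 ℓ Mh k P) (unitVec ν) z) = 1 := fun z hz =>
  ⟨(cutoffT_plateau_shifts D s' hMh hP (hlam z hz) ν ν).1, (cutoffT_plateau_shifts D s' hMh hP (hlam z hz) ν ν).2.1⟩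

/-- the near cut-off has the same plateau. [cite: Balaban1985BackgroundPropagators, (3.44) p.398, dictionary] -/
theorem nearCut_plateau_supp (hMh : 1 ≤ Mh) (hP : ∀ μ, 1 ≤ P μ) (ν : Fin (d + 1)) (lam : ↥(boxDom (N0 ℓ Mh k P)) → ℝ)
    (hlam : ∀ z, lam z ≠ 0 → blkOf D.toDomains z = s') :
    ∀ z, lam z ≠ 0 → nearCut D s s' z = 1 ∧ nearCut D s s' (tshift (N0 ℓ Mh k P) (unitVec ν) z) = 1 := fun z hz =>
  ⟨nearCut_eq_one_of D s s' (Or.inr (cutoffT_plateau_supp D s' hMh hP ν lam hlam z hz).1),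
   nearCut_eq_one_of D s s' (Or.inr (cutoffT_plateau_supp D s' hMh hP ν lam hlam z hz).2)⟩

/-- **THE NEAR STENCIL**: for `x ∈ B(s)`, `nearCut(x) = nearCut(x + e_μ) = 1`. [cite: Balaban1985BackgroundPropagators, (3.44) p.398 («x ∈ Δ(y)»), dictionary] -/
theorem nearCut_near_stencil (hMh : 1 ≤ Mh) (hP : ∀ μ, 1 ≤ P μ) (μ : Fin (d + 1)) {x : ↥(boxDom (N0 ℓ Mh k P))}
    (hx : blkOf D.toDomains x = s) :
    nearCut D s s' x = 1 ∧ nearCut D s s' (tshift (N0 ℓ Mh k P) (unitVec μ) x) = 1 :=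
  ⟨nearCut_eq_one_of D s s' (Or.inl (cutoffT_plateau_shifts D s hMh hP hx μ μ).1),
   nearCut_eq_one_of D s s' (Or.inl (cutoffT_plateau_shifts D s hMh hP hx μ μ).2.1)⟩

/-- **THE FAR STENCIL**: if `d_T(s, s′) > c₀ + 2(d+1)` then `χ_{s′}(x) = χ_{s′}(x + e_μ) = 0` for `x ∈ B(s)`.
[cite: Balaban1985BackgroundPropagators, (3.44) p.398; Balaban1984PropagatorsII, (2.46) p.231, dictionary] -/
theorem cutoffT_far_stencil (hℓ : 1 ≤ ℓ) (hMh : 3 ≤ Mh) (hR : 2 * (ℓ + 1) ≤ R) (hP4 : ∀ μ, 4 ≤ P μ) (μ : Fin (d + 1))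
    {x : ↥(boxDom (N0 ℓ Mh k P))} (hx : blkOf D.toDomains x = s) (hfar : c0 d ℓ + 2 * (d + 1) < (bondT D).dist s s') :
    cutoffT D s' x = 0 ∧ cutoffT D s' (tshift (N0 ℓ Mh k P) (unitVec μ) x) = 0 := by
  have h1 : ∀ κ, |(0 : Fin (d + 1) → ℤ) κ| ≤ 1 := fun κ => by simp
  have h2 : ∀ κ, |unitVec (d := d) μ κ| ≤ 1 := fun κ => (B9Ineq344DualComparisonTorus.abs_unitVec_le_one μ κ).1
  constructor
  · by_contra hc
    have h := mem_nbhdT_of_cutoffT_tshift_ne_zero D hℓ hMh hR hP4 s' x 0 h1 (by rwa [tshift_zero])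
    rw [mem_nbhdT, hx] at h
    omega
  · by_contra hc
    have h := mem_nbhdT_of_cutoffT_tshift_ne_zero D hℓ hMh hR hP4 s' x (unitVec μ) h2 hc
    rw [mem_nbhdT, hx] at h
    omega

end Stencil

/-! ## §4 The (2.61)-count of `𝒩_r(s′)` and the row-sum shape of the reduction's right-hand side -/

section Count

variable {ℓ Mh k R : ℕ} {P : Fin (d + 1) → ℕ} (D : TDomains d ℓ Mh k P R)

/-- **THE COUNT OF `𝒩_r(s′)` FROM (2.61)**: `#𝒩_r(s′) ≤ c·e^{¼δr}` whenever `Σ_t e^{−¼δ d_T(s′,t)} ≤ c`.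
[cite: Balaban1984PropagatorsII, Lemma 2.1 (2.61) p.234] -/
theorem card_nbhdT_le {c δ : ℝ} (hδ : 0 ≤ δ) (h261 : Ineq261With c (geomT D) δ (1 / 4)) (s' : ↥(bset D.toDomains)) (r : ℕ) :
    ((nbhdT D s' r).card : ℝ) ≤ c * Real.exp (1 / 4 * δ * r) := by
  classical
  have hsum := h261 s'
  have hpos : 0 < Real.exp (1 / 4 * δ * r) := Real.exp_pos _
  -- each member of `𝒩_r(s′)` contributes at least `e^{−¼δr}` to the (2.61) row sum at `s′`
  have hmem : ∀ t ∈ nbhdT D s' r, Real.exp (-(1 / 4 * δ * r)) ≤ Real.exp (-(1 / 4 * δ * (geomT D).dist s' t)) := by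
    intro t ht
    rw [mem_nbhdT] at ht
    refine Real.exp_le_exp.2 (neg_le_neg (mul_le_mul_of_nonneg_left ?_ (by positivity)))
    show (((bondT D).dist s' t : ℕ) : ℝ) ≤ r
    rw [SimpleGraph.dist_comm]; exact_mod_cast ht
  have h1 : ((nbhdT D s' r).card : ℝ) * Real.exp (-(1 / 4 * δ * r))
      ≤ ∑ t ∈ nbhdT D s' r, Real.exp (-(1 / 4 * δ * (geomT D).dist s' t)) := by
    rw [← nsmul_eq_mul, ← Finset.sum_const]
    exact Finset.sum_le_sum hmem
  have h2 : ∑ t ∈ nbhdT D s' r, Real.exp (-(1 / 4 * δ * (geomT D).dist s' t)) ≤ c :=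
    (Finset.sum_le_sum_of_subset_of_nonneg (Finset.subset_univ _) (fun _ _ _ => (Real.exp_pos _).le)).trans hsum
  have h3 : ((nbhdT D s' r).card : ℝ) * Real.exp (-(1 / 4 * δ * r)) ≤ c := h1.trans h2
  rw [Real.exp_neg, ← div_eq_mul_inv, div_le_iff₀ hpos] at h3
  exact h3

/-- ★ **THE ROW-SUM SHAPE OF THE REDUCTION'S RIGHT-HAND SIDE**: over `𝒩_r(s′)`,
`Σ_{t∈𝒩_r(s′)} e^{−½δ₀ d_T(s,t)} ≤ #𝒩_r(s′)·e^{½δ₀r}·e^{−½δ₀ d_T(s,s′)}` (triangle inequality `d_T(s,s′) ≤ d_T(s,t) + r`).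
[cite: Balaban1984PropagatorsII, (2.46) p.231, Lemma 2.1 (2.61) p.234, dictionary] -/
theorem sum_nbhdT_weight_le (hMh : 1 ≤ Mh) (hP : ∀ μ, 1 ≤ P μ) {δ₀ : ℝ} (hδ₀ : 0 ≤ δ₀) (s s' : ↥(bset D.toDomains)) (r : ℕ) :
    ∑ t ∈ nbhdT D s' r, Real.exp (-(δ₀ / 2 * (geomT D).dist s t))
      ≤ ((nbhdT D s' r).card : ℝ) * Real.exp (δ₀ / 2 * r) * Real.exp (-(δ₀ / 2 * (geomT D).dist s s')) := by
  classical
  have hmem : ∀ t ∈ nbhdT D s' r, Real.exp (-(δ₀ / 2 * (geomT D).dist s t))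
      ≤ Real.exp (δ₀ / 2 * r) * Real.exp (-(δ₀ / 2 * (geomT D).dist s s')) := by
    intro t ht
    rw [mem_nbhdT] at ht
    rw [← Real.exp_add]
    refine Real.exp_le_exp.2 ?_
    have htri := (connectedT (D := D) hMh hP).dist_triangle (u := s) (v := t) (w := s')
    have h1 : (((bondT D).dist s s' : ℕ) : ℝ) ≤ (((bondT D).dist s t : ℕ) : ℝ) + r := by
      have : (((bondT D).dist s s' : ℕ) : ℝ) ≤ (((bondT D).dist s t + (bondT D).dist t s' : ℕ) : ℝ) := by exact_mod_cast htri
      have h2 : (((bondT D).dist t s' : ℕ) : ℝ) ≤ r := by exact_mod_cast ht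
      push_cast at this; linarith
    show -(δ₀ / 2 * (((bondT D).dist s t : ℕ) : ℝ)) ≤ δ₀ / 2 * r + -(δ₀ / 2 * (((bondT D).dist s s' : ℕ) : ℝ))
    nlinarith
  calc ∑ t ∈ nbhdT D s' r, Real.exp (-(δ₀ / 2 * (geomT D).dist s t))
      ≤ ∑ _t ∈ nbhdT D s' r, Real.exp (δ₀ / 2 * r) * Real.exp (-(δ₀ / 2 * (geomT D).dist s s')) := Finset.sum_le_sum hmem
    _ = _ := by rw [Finset.sum_const, nsmul_eq_mul]; ring

end Count

end Literature.MathematicalPhysics.QuantumFieldTheory.Balaban1983to89.B9Ineq344CutoffDatumTorus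

end
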